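import Summits.ABC.StewartYu.ArchG3RecEndC
import Summits.ABC.StewartYu.ArchG3RecEndNum
import HarnessLib

/-!
# The archimedean record of reference `ArchG3Rec` — clause (N) of `RecordArchW`: the numeric comparison `NCarch(n, r)`

Support file (elementary theorems; no named facts, no definitions). Cell `abc-stewartyu`, route `YuMatveevShapeRat`, crux r2
`ArchCoreRat` (stmt-ABC-20502; parcel (r2-c), seat p4 g10). Clause (N) of `GenThreeFrameSpecArchW.RecordArchW (c^·) Y n …`
asks, for `0 < r < n`: `0 < Y r`, `r(n+1) ≤ Y r·cⁿ` and `2cʳ + Y r ≤ Y r·cⁿ`.  At the slack function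
`Y = RecordExits.Yslack (C_bⁿK) n` of the covolume clause (`RecordExitCCappedKeys`) and for every `c ≥ 2^100` all three
follow from `4(n+1)·cʳ ≤ Y r·cⁿ`, i.e. (with `C_b ≤ 87`, `K ≤ n·22027·2981ⁿ + 2`) from the INTEGER inequality

* `NCarch n r : 4(n+1)·(r!)³nʳ(n+1)!(n+2)^{4r}·87ⁿ(n·22027·2981ⁿ+2)·2^{100r} ≤ (16(n+1))ʳ(2^{n+21})ʳ2^{n+20}(n−r)!·2^{100n}`,

proved by `decide` for `n ≤ 64` (kernel arithmetic, all `0 < r < n`; the exact minimum exponent is `80`, attained at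
`(n, r) = (14, 13)`) and by exponent counting for `n ≥ 64` (`(n+2)⁸ ≤ 2ⁿ` there; template `RecordNumericC`).
`clauseN` is clause (N) BY NAME for `ArchG3Rec`'s slack function and any `c ≥ 2^100`.

WHAT THIS IS NOT: no crux moves; the assembly of `RecordArchW` is `ArchG3RecordW`.

References: Yu. V. Nesterenko, LNM 1819 (2003), §5.2 (5.21)–(5.22); E. M. Matveev, Izv. Math. 64 (2000), (1.3).
-/

noncomputable section

open Finset Real Nat

namespace Summit.ABC.StewartYu

namespace RecordExitsNumeric

/-! ### Small `n`: kernel arithmetic -/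

set_option exponentiation.threshold 1000000 in
set_option maxRecDepth 100000 in
/-- `NCarch n r` for `n ≤ 64`, all `0 < r < n` (decided by the kernel). [folklore] -/
theorem ncArch_small : ∀ n, n ≤ 64 → ∀ r, r < n → 0 < r →
    4 * (n + 1) * (r ! ^ 3 * n ^ r * (n + 1)! * (n + 2) ^ (4 * r)) * (87 ^ n * (n * 22027 * 2981 ^ n + 2)) *
        2 ^ (100 * r) ≤
      (16 * (n + 1)) ^ r * (2 ^ (n + 21)) ^ r * 2 ^ (n + 20) * (n - r)! * 2 ^ (100 * n) := by
  decide

/-! ### Large `n`: exponent counting -/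

/-- `NCarch` for `n ≥ 64`, in the subtraction-free parametrisation `r = s+1`, `n = s+2+t`. [folklore] -/
theorem ncArch_large (s t : ℕ) (hn : 64 ≤ s + 2 + t) :
    4 * (s + 2 + t + 1) * ((s + 1)! ^ 3 * (s + 2 + t) ^ (s + 1) * (s + 2 + t + 1)! * (s + 2 + t + 2) ^ (4 * (s + 1))) *
        (87 ^ (s + 2 + t) * ((s + 2 + t) * 22027 * 2981 ^ (s + 2 + t) + 2)) * 2 ^ (100 * (s + 1)) ≤
      (16 * (s + 2 + t + 1)) ^ (s + 1) * (2 ^ (s + 2 + t + 21)) ^ (s + 1) * 2 ^ (s + 2 + t + 20) * (t + 1)! *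
        2 ^ (100 * (s + 2 + t)) := by
  set n := s + 2 + t with hn'
  have h8 := pow_eight_le_two_pow_self hn
  have hK := ArchG3Rec.Knat_lt_two_pow n
  have h87 : 87 ^ n ≤ 2 ^ (7 * n) := by rw [pow_mul]; exact Nat.pow_le_pow_left (by norm_num) n
  have hf : (n + 1)! ≤ (n + 1) ^ (s + 2) * (t + 1)! := by
    have := factorial_le_pow_mul_factorial (n := n) (j := s + 2) (by omega)
    rwa [show n + 1 - (s + 2) = t + 1 by omega] at this
  have hr1 : (s + 1)! ≤ (n + 2) ^ (s + 1) :=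
    (Nat.factorial_le_pow _).trans (Nat.pow_le_pow_left (by omega) _)
  have hnp : n ^ (s + 1) ≤ (n + 2) ^ (s + 1) := Nat.pow_le_pow_left (by omega) _
  -- replace every factor by its crude bound
  have step : 4 * (n + 1) * ((s + 1)! ^ 3 * n ^ (s + 1) * (n + 1)! * (n + 2) ^ (4 * (s + 1))) *
        (87 ^ n * (n * 22027 * 2981 ^ n + 2)) * 2 ^ (100 * (s + 1)) ≤
      4 * (n + 1) * (((n + 2) ^ (s + 1)) ^ 3 * (n + 2) ^ (s + 1) * ((n + 1) ^ (s + 2) * (t + 1)!) *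
        (n + 2) ^ (4 * (s + 1))) * (2 ^ (7 * n) * 2 ^ (13 * n + 16)) * 2 ^ (100 * (s + 1)) :=
    Nat.mul_le_mul (Nat.mul_le_mul (Nat.mul_le_mul_left _ (Nat.mul_le_mul (Nat.mul_le_mul (Nat.mul_le_mul
      (Nat.pow_le_pow_left hr1 3) hnp) hf) le_rfl)) (Nat.mul_le_mul h87 hK.le)) le_rfl
  refine step.trans ?_
  -- the polynomial part: `4(n+1)·(n+2)^{8(s+1)}·(n+1)^{s+2} ≤ 4·(2ⁿ)^{s+2}·(n+1)^{s+1}` (`(n+2)⁸ ≤ 2ⁿ`)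
  have hn12 : (n + 1) ^ 2 ≤ (n + 2) ^ 2 := Nat.pow_le_pow_left (by omega) 2
  have hpoly : 4 * (n + 1) * (((n + 2) ^ (s + 1)) ^ 3 * (n + 2) ^ (s + 1) * ((n + 1) ^ (s + 2)) *
        (n + 2) ^ (4 * (s + 1))) ≤ 4 * (2 ^ n) ^ (s + 2) * (n + 1) ^ (s + 1) := by
    calc 4 * (n + 1) * (((n + 2) ^ (s + 1)) ^ 3 * (n + 2) ^ (s + 1) * ((n + 1) ^ (s + 2)) * (n + 2) ^ (4 * (s + 1)))
        = 4 * (((n + 2) ^ (s + 1)) ^ 3 * (n + 2) ^ (s + 1) * (n + 2) ^ (4 * (s + 1)) * (n + 1) ^ 2) *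
            (n + 1) ^ (s + 1) := by ring
      _ ≤ 4 * (((n + 2) ^ (s + 1)) ^ 3 * (n + 2) ^ (s + 1) * (n + 2) ^ (4 * (s + 1)) * (n + 2) ^ 2) *
            (n + 1) ^ (s + 1) := Nat.mul_le_mul_right _ (Nat.mul_le_mul_left _ (Nat.mul_le_mul_left _ hn12))
      _ = 4 * (n + 2) ^ (8 * (s + 1) + 2) * (n + 1) ^ (s + 1) := by ring
      _ ≤ 4 * (n + 2) ^ (8 * (s + 2)) * (n + 1) ^ (s + 1) :=
          Nat.mul_le_mul_right _ (Nat.mul_le_mul_left _ (Nat.pow_le_pow_right (by omega) (by omega)))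
      _ = 4 * ((n + 2) ^ 8) ^ (s + 2) * (n + 1) ^ (s + 1) := by rw [← pow_mul]
      _ ≤ 4 * (2 ^ n) ^ (s + 2) * (n + 1) ^ (s + 1) :=
          Nat.mul_le_mul_right _ (Nat.mul_le_mul_left _ (Nat.pow_le_pow_left h8 _))
  calc 4 * (n + 1) * (((n + 2) ^ (s + 1)) ^ 3 * (n + 2) ^ (s + 1) * ((n + 1) ^ (s + 2) * (t + 1)!) *
          (n + 2) ^ (4 * (s + 1))) * (2 ^ (7 * n) * 2 ^ (13 * n + 16)) * 2 ^ (100 * (s + 1))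
      = (4 * (n + 1) * (((n + 2) ^ (s + 1)) ^ 3 * (n + 2) ^ (s + 1) * ((n + 1) ^ (s + 2)) *
          (n + 2) ^ (4 * (s + 1)))) * ((t + 1)! * (2 ^ (7 * n) * 2 ^ (13 * n + 16)) * 2 ^ (100 * (s + 1))) := by
        ring
    _ ≤ (4 * (2 ^ n) ^ (s + 2) * (n + 1) ^ (s + 1)) *
          ((t + 1)! * (2 ^ (7 * n) * 2 ^ (13 * n + 16)) * 2 ^ (100 * (s + 1))) :=
        Nat.mul_le_mul_right _ hpoly
    _ = ((n + 1) ^ (s + 1) * (t + 1)!) *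
          2 ^ (2 + n * (s + 2) + 7 * n + (13 * n + 16) + 100 * (s + 1)) := by
        rw [show (4 : ℕ) = 2 ^ 2 by norm_num, ← pow_mul]
        simp only [pow_add]
        ring
    _ ≤ ((n + 1) ^ (s + 1) * (t + 1)!) *
          2 ^ (4 * (s + 1) + (n + 21) * (s + 1) + (n + 20) + 100 * n) := by
        apply Nat.mul_le_mul_left
        apply Nat.pow_le_pow_right (by norm_num)
        rw [hn']; nlinarith
    _ = (16 * (n + 1)) ^ (s + 1) * (2 ^ (n + 21)) ^ (s + 1) * 2 ^ (n + 20) * (t + 1)! * 2 ^ (100 * n) := by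
        rw [show (16 : ℕ) = 2 ^ 4 by norm_num, mul_pow, ← pow_mul, ← pow_mul]
        simp only [pow_add]
        ring

/-- **`NCarch n r`** for all `0 < r < n`. [folklore] -/
theorem ncArch_nat (n r : ℕ) (hr0 : 0 < r) (hrn : r < n) :
    4 * (n + 1) * (r ! ^ 3 * n ^ r * (n + 1)! * (n + 2) ^ (4 * r)) * (87 ^ n * (n * 22027 * 2981 ^ n + 2)) *
        2 ^ (100 * r) ≤
      (16 * (n + 1)) ^ r * (2 ^ (n + 21)) ^ r * 2 ^ (n + 20) * (n - r)! * 2 ^ (100 * n) := by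
  rcases Nat.lt_or_ge n 65 with hn | hn
  · exact ncArch_small n (by omega) r hrn hr0
  · obtain ⟨s, rfl⟩ : ∃ s, r = s + 1 := ⟨r - 1, by omega⟩
    obtain ⟨t, rfl⟩ : ∃ t, n = s + 2 + t := ⟨n - s - 2, by omega⟩
    rw [show s + 2 + t - (s + 1) = t + 1 by omega]
    exact ncArch_large s t (by omega)

end RecordExitsNumeric

namespace ArchG3Rec

open PadicG3Par (Cb Cb_pos Cb_le sixtyfour_le_Cb)
open ArchG3Par (K K_pos one_le_K)

/-! ### Back to the reals: clause (N) -/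

/-- `C_bⁿ·K ≤ 87ⁿ·(n·22027·2981ⁿ + 2)` in `ℝ`. [folklore] -/
theorem CbK_le_nat (n : ℕ) : Cb ^ n * (K n : ℝ) ≤ ((87 ^ n * (n * 22027 * 2981 ^ n + 2) : ℕ) : ℝ) := by
  have h1 : Cb ^ n ≤ (87 : ℝ) ^ n := pow_le_pow_left₀ Cb_pos.le Cb_le n
  have h2 : (K n : ℝ) ≤ ((n * 22027 * 2981 ^ n + 2 : ℕ) : ℝ) := by exact_mod_cast K_le_Knat n
  push_cast at h2 ⊢
  exact mul_le_mul h1 h2 (K_pos n).le (by positivity)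

/-- **The core of clause (N)**: `4(n+1)·cʳ ≤ Y r·cⁿ` for `Y = Yslack (C_bⁿK) n`, `0 < r < n`, `c ≥ 2^100`.
[cite: Nesterenko2003, §5.2 (5.21)–(5.22); shape only] -/
theorem four_mul_pow_le_Y_mul_pow {n r : ℕ} (hr0 : 0 < r) (hrn : r < n) {c : ℝ} (hc : (2 : ℝ) ^ 100 ≤ c) :
    4 * ((n : ℝ) + 1) * c ^ r ≤ RecordExits.Yslack (Cb ^ n * K n) n r * c ^ n := by
  have hnat := RecordExitsNumeric.ncArch_nat n r hr0 hrn
  have hR : ((4 * (n + 1) * (r ! ^ 3 * n ^ r * (n + 1)! * (n + 2) ^ (4 * r)) *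
      (87 ^ n * (n * 22027 * 2981 ^ n + 2)) * 2 ^ (100 * r) : ℕ) : ℝ) ≤
      (((16 * (n + 1)) ^ r * (2 ^ (n + 21)) ^ r * 2 ^ (n + 20) * (n - r)! * 2 ^ (100 * n) : ℕ) : ℝ) := by
    exact_mod_cast hnat
  have hcK := CbK_le_nat n
  have hcK0 : 0 < Cb ^ n * (K n : ℝ) := by have := K_pos n; have := Cb_pos; positivity
  have hc0 : 0 < c := lt_of_lt_of_le (by positivity) hc
  -- `c = 2^100 · q`, `q ≥ 1`
  set q : ℝ := c / 2 ^ 100 with hq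
  have hq1 : 1 ≤ q := by rw [hq, le_div_iff₀ (by positivity)]; linarith
  have hcq : c = 2 ^ 100 * q := by rw [hq]; field_simp
  have hqpow : q ^ r ≤ q ^ n := pow_le_pow_right₀ hq1 hrn.le
  have hden : (0 : ℝ) < ((r ! : ℕ) : ℝ) ^ 3 * (n : ℝ) ^ r * (((n + 1)! : ℕ) : ℝ) * ((n : ℝ) + 2) ^ (4 * r) := by
    have h1 : (0 : ℝ) < ((r ! : ℕ) : ℝ) := by exact_mod_cast Nat.factorial_pos r
    have h3 : (0 : ℝ) < (((n + 1)! : ℕ) : ℝ) := by exact_mod_cast Nat.factorial_pos _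
    have h4 : (0 : ℝ) < (n : ℝ) := by exact_mod_cast (lt_of_le_of_lt (Nat.zero_le _) hrn)
    positivity
  unfold RecordExits.Yslack
  rw [div_mul_eq_mul_div, le_div_iff₀ (mul_pos hden hcK0), hcq]
  push_cast at hR hcK
  rw [show (2 : ℝ) ^ (100 * r) = (2 ^ 100) ^ r from pow_mul 2 100 r,
    show (2 : ℝ) ^ (100 * n) = (2 ^ 100) ^ n from pow_mul 2 100 n] at hR
  calc 4 * ((n : ℝ) + 1) * (2 ^ 100 * q) ^ r *
        (((r ! : ℕ) : ℝ) ^ 3 * (n : ℝ) ^ r * (((n + 1)! : ℕ) : ℝ) * ((n : ℝ) + 2) ^ (4 * r) * (Cb ^ n * (K n : ℝ)))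
      = (4 * ((n : ℝ) + 1) * (((r ! : ℕ) : ℝ) ^ 3 * (n : ℝ) ^ r * (((n + 1)! : ℕ) : ℝ) * ((n : ℝ) + 2) ^ (4 * r)) *
          (Cb ^ n * (K n : ℝ)) * (2 ^ 100) ^ r) * q ^ r := by ring
    _ ≤ (4 * ((n : ℝ) + 1) * (((r ! : ℕ) : ℝ) ^ 3 * (n : ℝ) ^ r * (((n + 1)! : ℕ) : ℝ) * ((n : ℝ) + 2) ^ (4 * r)) *
          ((87 : ℝ) ^ n * ((n : ℝ) * 22027 * 2981 ^ n + 2)) * (2 ^ 100) ^ r) * q ^ n := by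
        apply mul_le_mul _ hqpow (by positivity) (by positivity)
        gcongr
    _ ≤ ((16 * ((n : ℝ) + 1)) ^ r * ((2 : ℝ) ^ (n + 21)) ^ r * 2 ^ (n + 20) * (((n - r)! : ℕ) : ℝ) * (2 ^ 100) ^ n) *
          q ^ n := mul_le_mul_of_nonneg_right hR (by positivity)
    _ = (16 * ((n : ℝ) + 1)) ^ r * ((2 : ℝ) ^ (n + 21)) ^ r * 2 ^ (n + 20) * (((n - r)! : ℕ) : ℝ) *
          (2 ^ 100 * q) ^ n := by ring

/-- **CLAUSE (N) of `RecordArchW` for `ArchG3Rec`'s slack function**: for `0 < r < n` and every `c ≥ 2^100`,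
`0 < Y r`, `r(n+1) ≤ Y r·cⁿ` and `2cʳ + Y r ≤ Y r·cⁿ` (`Y = Yslack (C_bⁿK) n`).
[cite: Nesterenko2003, §5.2 (5.21)–(5.22); shape only] [cite: Matveev2000, (1.3); shape only] -/
theorem clauseN {n : ℕ} {c : ℝ} (hc : (2 : ℝ) ^ 100 ≤ c) :
    ∀ r : ℕ, 0 < r → r < n →
      0 < RecordExits.Yslack (Cb ^ n * K n) n r ∧
      (r : ℝ) * (n + 1) ≤ RecordExits.Yslack (Cb ^ n * K n) n r * (fun m : ℕ => c ^ m) n ∧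
      2 * (fun m : ℕ => c ^ m) r + RecordExits.Yslack (Cb ^ n * K n) n r ≤
        RecordExits.Yslack (Cb ^ n * K n) n r * (fun m : ℕ => c ^ m) n := by
  intro r hr0 hrn
  have hcK0 : 0 < Cb ^ n * (K n : ℝ) := by have := K_pos n; have := Cb_pos; positivity
  have hY := RecordExits.Yslack_pos hcK0 (show 1 ≤ n by omega) r
  have hmain := four_mul_pow_le_Y_mul_pow hr0 hrn hc
  have hc1 : (2 : ℝ) ≤ c := le_trans (by norm_num) hc
  have hcr : (2 : ℝ) ≤ c ^ r := by
    calc (2 : ℝ) = 2 ^ 1 := by norm_num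
      _ ≤ 2 ^ r := pow_le_pow_right₀ (by norm_num) hr0
      _ ≤ c ^ r := pow_le_pow_left₀ (by norm_num) hc1 r
  have hcn : (2 : ℝ) ≤ c ^ n := by
    calc (2 : ℝ) = 2 ^ 1 := by norm_num
      _ ≤ 2 ^ n := pow_le_pow_right₀ (by norm_num) (by omega)
      _ ≤ c ^ n := pow_le_pow_left₀ (by norm_num) hc1 n
  have hr1 : (1 : ℝ) ≤ r := by exact_mod_cast hr0
  have hrr : (r : ℝ) ≤ 2 ^ r := by
    have : r < 2 ^ r := Nat.lt_two_pow_self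
    exact_mod_cast this.le
  have hr2 : (r : ℝ) ≤ c ^ r := hrr.trans (pow_le_pow_left₀ (by norm_num) hc1 r)
  have hn0 : (0 : ℝ) ≤ n := Nat.cast_nonneg n
  refine ⟨hY, ?_, ?_⟩
  · -- `r(n+1) ≤ 4(n+1)cʳ ≤ Y cⁿ`
    simp only
    nlinarith
  · -- `2cʳ + Y ≤ 4(n+1)cʳ/2 + Y cⁿ/2 ≤ Y cⁿ`
    simp only
    nlinarith

end ArchG3Rec

end Summit.ABC.StewartYu

end
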